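import Literature.Geometry.Lorentzian.KerrIntegratedDecayUniform
import Literature.Geometry.Lorentzian.KerrTimeDerivativeSupport
import Literature.Geometry.Lorentzian.KerrSurfaceGravity
import HarnessLib

/-!
# Integrated local energy decay on near-extremal Kerr with a `κ`-explicit constant: the reduction of
# a graph statement of Dafermos–Rodnianski–Shlapentokh-Rothman type (data of order `j`) to the
# Kerr–Schild leaf `{t*_KS = 0}`

`KerrIntegratedDecay.lean` / `KerrIntegratedDecayUniform.lean` vendor DRSR arXiv:1402.7034, Thm. 3.2
(25) (`j = 2`) as integrated local energy decay through the Kerr–Schild graphs `{t*_KS = F(y)}` of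
admissible height functions flat on a ball `{‖y‖ ≤ ρ}`, for the class `IsAdmissibleKerrWaveOn M a F`,
and `drsr_wave_integrated_decay_kerr_of_DRSR` (Dafermos–Rodnianski arXiv:1010.5132, §4.6,
Prop. 4.6.1) reduces that to the leaf form (`IsAdmissibleKerrWave`, data energy `E₂[ψ](0)` on the
whole leaf `{t*_KS = 0}`). The `κ`-explicit programme near extremality (crux
`PhaseMixingCapture.KappaExplicitWaveDecay` of the summit `FinalStateConjecture`, clause (b) on a
range `a₁ ≤ |a| < M`; DRSR §§5–12 with constants polynomial in `κ⁻¹`, the powers of the separation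
constant `Λ` in the cone Green-kernel bounds being paid by the ORDER `j` of the data) produces a
statement of the same shape with general `j`: on the flat part the `j`-th order coordinate energy,
on the bent far part (where DRSR's `N = T`) the first-order graph energies of the commuted fields
`T^i ψ`, `i < j` (the right-hand side `∑_{i ≤ j−1} ∫_{Σ̃₀} J^N[N^iψ]·n` of (25)), and the constant
`C · (1 − (a/M)²)^{-p}`. This file proves the corresponding reduction once and for all:

* `coordEnergyDensity_timeDeriv_iterate_le`, `sliceEnergy_timeDeriv_iterate_le` — the coordinate
  energy of `T^k ψ` is at most `4 E_{k+1}[ψ]` (the extension by zero of `T^k ψ` is, near every point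
  of the open set, `z ↦ D^kψ̃(z)(∂_{t*}, …, ∂_{t*})`, `extend_timeDeriv_iterate_eventuallyEq`);
* `Kerr.farRadius_le_of_isSubextremal` — `R_far(M, a) ≤ 293M + 2` for `|a| < M` (a-uniform scale);
* `kerr_nearExtremal_integratedDecay_of_graphILED` — **the reduction**: the graph statement (written
  out as the hypothesis; no definition is introduced) implies the leaf statement with the same
  `a₁`, `p`, `j` and constant `(1 + 32 j) C`. Proof: the `a`-uniform Dafermos–Rodnianski reduction:
  `a`-free scale `λ = max (4A, 4Ms, 293M + 2, R₀, R)` and height `heightFn M λ`; finite speed of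
  propagation (`kerr_far_finite_speed_of_propagation`) puts every admissible wave — and every `T^i ψ`
  (`IsAdmissibleKerrWave.timeDeriv_iterate`) — in the class `IsAdmissibleKerrWaveOn M a F` with far
  graph energy `≤ 8 ×` its energy through `{t*_KS = 0}` (`kerr_far_TEnergy_comparison_of_farRadius_le`),
  and `sliceEnergy (T^i ψ) 0 ≤ 4 E_{i+1}[ψ](0) ≤ 4 E_j[ψ](0)` for `i < j`.

Nothing is claimed here about the graph statement itself (it is the hypothesis). No definitions, no
named facts.

## References

* M. Dafermos, I. Rodnianski, Y. Shlapentokh-Rothman, Ann. of Math. 183 (2016) = arXiv:1402.7034,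
  Thm. 3.2 (25), §3.3 (key `DafermosRodnianskiShlapentokhrothman2014`).
* M. Dafermos, I. Rodnianski, arXiv:1010.5132, §4.4 Def. 4.1, §4.6 Prop. 4.6.1
  (key `DafermosRodnianski2010KerrSmallA`).
-/

noncomputable section

namespace Literature.Geometry.Lorentzian

open MeasureTheory Filter Set Complex TopologicalSpace
open scoped Topology Manifold ENNReal ContDiff

/-! ### The coordinate energy of `T^k ψ` below the Sobolev energy of order `k + 1` -/

/-- Near a point of the open set `U`, the extension by zero of `T^k ψ` is the global function
`z ↦ D^kψ̃(z)(∂_{t*}, …, ∂_{t*})` (`ψ̃` the extension by zero of `ψ`, smooth near `U`). [folklore] -/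
theorem extend_timeDeriv_iterate_eventuallyEq {U : Opens E4} {ψ : U → ℝ}
    (hψ : ContMDiff 𝓘(ℝ, E4) 𝓘(ℝ, ℝ) ∞ ψ) (k : ℕ) (x : U) :
    Function.extend Subtype.val (timeDeriv^[k] ψ) 0 =ᶠ[𝓝 (x : E4)]
      fun z ↦ iteratedFDeriv ℝ k (Function.extend Subtype.val ψ 0) z
        (fun _ ↦ E4.basisVector 0) := by
  induction k generalizing x with
  | zero =>
    exact Eventually.of_forall fun z ↦ by simp
  | succ k ih =>
    set Φ : E4 → ℝ := Function.extend Subtype.val ψ 0 with hΦ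
    rw [Function.iterate_succ_apply']
    have h1 := extend_timeDeriv_eventuallyEq (timeDeriv^[k] ψ) x
    have h2 : ∀ᶠ z in 𝓝 (x : E4),
        fderiv ℝ (Function.extend Subtype.val (timeDeriv^[k] ψ) 0) z (E4.basisVector 0) =
          iteratedFDeriv ℝ (k + 1) Φ z (fun _ ↦ E4.basisVector 0) := by
      filter_upwards [U.isOpen.mem_nhds x.2] with z hz
      rw [(ih ⟨z, hz⟩).fderiv_eq]
      have hΦz : ContDiffAt ℝ ((k + 2 : ℕ) : ℕ∞) Φ z :=
        (contDiffAt_extend hψ ⟨z, hz⟩).of_le (by exact_mod_cast le_top)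
      have hdiff : DifferentiableAt ℝ (iteratedFDeriv ℝ k Φ) z :=
        hΦz.differentiableAt_iteratedFDeriv (by exact_mod_cast (by omega : k < k + 2))
      rw [fderiv_continuousMultilinear_apply_const_apply hdiff, iteratedFDeriv_succ_apply_left]
      rfl
    exact h1.trans h2

/-- **The energy density of `T^k ψ` is at most `4 ‖D^{k+1}ψ̃‖²`** at points of `U`, for smooth `ψ`:
`∂_μ(T^kψ) = D^{k+1}ψ̃(e_μ, e₀, …, e₀)`. [folklore] -/
theorem coordEnergyDensity_timeDeriv_iterate_le {U : Opens E4} {ψ : U → ℝ}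
    (hψ : ContMDiff 𝓘(ℝ, E4) 𝓘(ℝ, ℝ) ∞ ψ) (k : ℕ) (x : U) :
    coordEnergyDensity U (timeDeriv^[k] ψ) x ≤
      4 * ‖iteratedFDeriv ℝ (k + 1) (Function.extend Subtype.val ψ 0) x‖ ^ 2 := by
  set Φ : E4 → ℝ := Function.extend Subtype.val ψ 0 with hΦ
  have hD : fderiv ℝ (Function.extend Subtype.val (timeDeriv^[k] ψ) 0) x =
      fderiv ℝ (fun z ↦ iteratedFDeriv ℝ k Φ z (fun _ ↦ E4.basisVector 0)) x :=
    (extend_timeDeriv_iterate_eventuallyEq hψ k x).fderiv_eq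
  have hΦx : ContDiffAt ℝ ((k + 2 : ℕ) : ℕ∞) Φ x :=
    (contDiffAt_extend hψ x).of_le (by exact_mod_cast le_top)
  have hdiff : DifferentiableAt ℝ (iteratedFDeriv ℝ k Φ) x :=
    hΦx.differentiableAt_iteratedFDeriv (by exact_mod_cast (by omega : k < k + 2))
  have hcomp : ∀ μ : Fin 4,
      (fderiv ℝ (Function.extend Subtype.val (timeDeriv^[k] ψ) 0) x
        (EuclideanSpace.single μ (1 : ℝ))) ^ 2 ≤ ‖iteratedFDeriv ℝ (k + 1) Φ x‖ ^ 2 := by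
    intro μ
    set m : Fin (k + 1) → E4 := Fin.cons (EuclideanSpace.single μ (1 : ℝ))
      (fun _ ↦ E4.basisVector 0) with hm
    have hval : fderiv ℝ (Function.extend Subtype.val (timeDeriv^[k] ψ) 0) x
        (EuclideanSpace.single μ (1 : ℝ)) = iteratedFDeriv ℝ (k + 1) Φ x m := by
      rw [hD, fderiv_continuousMultilinear_apply_const_apply hdiff, iteratedFDeriv_succ_apply_left]
      simp [hm]
    have hm1 : ‖m‖ ≤ 1 := by
      refine (pi_norm_le_iff_of_nonneg zero_le_one).mpr fun i ↦ ?_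
      refine Fin.cases ?_ (fun j ↦ ?_) i
      · simp [hm]
      · simp [hm, E4.basisVector]
    have hle : ‖iteratedFDeriv ℝ (k + 1) Φ x m‖ ≤ ‖iteratedFDeriv ℝ (k + 1) Φ x‖ :=
      (iteratedFDeriv ℝ (k + 1) Φ x).unit_le_opNorm hm1
    rw [hval]
    rw [Real.norm_eq_abs] at hle
    exact sq_le_sq' (abs_le.mp hle).1 (abs_le.mp hle).2
  calc coordEnergyDensity U (timeDeriv^[k] ψ) x
      = ∑ μ : Fin 4, (fderiv ℝ (Function.extend Subtype.val (timeDeriv^[k] ψ) 0) x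
          (EuclideanSpace.single μ (1 : ℝ))) ^ 2 := rfl
    _ ≤ ∑ _μ : Fin 4, ‖iteratedFDeriv ℝ (k + 1) Φ x‖ ^ 2 := Finset.sum_le_sum fun μ _ ↦ hcomp μ
    _ = 4 * ‖iteratedFDeriv ℝ (k + 1) Φ x‖ ^ 2 := by simp

/-- **Energy of `T^k ψ` below the Sobolev energy of order `k + 1` of `ψ`**:
`sliceEnergy (T^kψ) τ ≤ 4 · E_{k+1+n}[ψ](τ)` for smooth `ψ` (the `m = k + 1` term dominates,
`coordEnergyDensity_timeDeriv_iterate_le`). This is the elementary half of "`∫ J^T[T^iψ] n` is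
controlled by the higher-order energy of the data" (DRSR arXiv:1402.7034, (25), (29)). [folklore] -/
theorem sliceEnergy_timeDeriv_iterate_le {U : Opens E4} {ψ : U → ℝ}
    (hψ : ContMDiff 𝓘(ℝ, E4) 𝓘(ℝ, ℝ) ∞ ψ) (τ : ℝ) (k n : ℕ) :
    sliceEnergy U (timeDeriv^[k] ψ) τ ≤ 4 * sliceSobolevEnergy U ψ τ (k + 1 + n) 0 univ := by
  unfold sliceEnergy sliceSobolevEnergy
  rw [Measure.restrict_univ, ← lintegral_const_mul' _ _ (by simp)]
  refine lintegral_mono fun y ↦ ?_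
  by_cases hy : E4.ofTimeSpace τ y ∈ U
  · rw [indicator_of_mem (show y ∈ {y : E3 | E4.ofTimeSpace τ y ∈ U} from hy),
      indicator_of_mem (show y ∈ {y : E3 | E4.ofTimeSpace τ y ∈ U} from hy), Real.rpow_zero,
      one_mul, ← ENNReal.ofReal_ofNat 4, ← ENNReal.ofReal_mul (by norm_num)]
    refine ENNReal.ofReal_le_ofReal ?_
    calc coordEnergyDensity U (timeDeriv^[k] ψ) (E4.ofTimeSpace τ y)
        ≤ 4 * ‖iteratedFDeriv ℝ (k + 1) (Function.extend Subtype.val ψ 0)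
            (E4.ofTimeSpace τ y)‖ ^ 2 :=
          coordEnergyDensity_timeDeriv_iterate_le hψ k ⟨_, hy⟩
      _ ≤ 4 * ∑ m ∈ Finset.range (k + 1 + n + 1),
            ‖iteratedFDeriv ℝ m (Function.extend Subtype.val ψ 0) (E4.ofTimeSpace τ y)‖ ^ 2 := by
          gcongr
          exact Finset.single_le_sum (f := fun m ↦
            ‖iteratedFDeriv ℝ m (Function.extend Subtype.val ψ 0) (E4.ofTimeSpace τ y)‖ ^ 2)
            (fun m _ ↦ sq_nonneg _) (Finset.mem_range.mpr (by omega))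
  · rw [indicator_of_notMem (show y ∉ {y : E3 | E4.ofTimeSpace τ y ∈ U} from hy),
      indicator_of_notMem (show y ∉ {y : E3 | E4.ofTimeSpace τ y ∈ U} from hy), mul_zero]

/-! ### Elementary inequalities -/

/-- **An `a`-uniform far radius**: `R_far(M, a) ≤ 293 M + 2` for sub-extremal `(M, a)`
(`R_far = max (R_af + 1) (290 M)`, `R_af = √(r₊² + a²) + 1`, `0 < r₊ ≤ 2M`, `|a| < M`). [folklore] -/
theorem Kerr.farRadius_le_of_isSubextremal {M a : ℝ} (hMa : Kerr.IsSubextremal M a) :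
    Kerr.farRadius M a ≤ 293 * M + 2 := by
  have hM : 0 < M := hMa.pos
  have hr : Kerr.rPlus M a ≤ 2 * M := Kerr.rPlus_le_two_mul_self hM.le a
  have hr0 : 0 < Kerr.rPlus M a := Kerr.rPlus_pos hM a
  have ha : |a| < M := hMa
  have ha2 : a ^ 2 ≤ M ^ 2 := by
    rw [← sq_abs a]
    exact pow_le_pow_left₀ (abs_nonneg a) ha.le 2
  have hsqrt : √((max (Kerr.rPlus M a) 0) ^ 2 + a ^ 2) ≤ 3 * M := by
    rw [max_eq_left hr0.le, Real.sqrt_le_left (by positivity)]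
    nlinarith
  unfold Kerr.farRadius Kerr.afRadius
  exact max_le (by linarith) (by linarith)

/-- The weighted coordinate energy is monotone in the order. [folklore] -/
theorem sliceSobolevEnergy_mono_order {U : Opens E4} (ψ : U → ℝ) (τ : ℝ) {k k' : ℕ} (hk : k ≤ k')
    (A : Set E3) : sliceSobolevEnergy U ψ τ k 0 A ≤ sliceSobolevEnergy U ψ τ k' 0 A := by
  unfold sliceSobolevEnergy
  refine lintegral_mono fun y ↦ Set.indicator_le_indicator (ENNReal.ofReal_le_ofReal ?_)
  refine mul_le_mul_of_nonneg_left ?_ (Real.rpow_nonneg (by positivity) _)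
  exact Finset.sum_le_sum_of_subset_of_nonneg (Finset.range_mono (by omega))
    fun _ _ _ ↦ sq_nonneg _

/-- The clause's right-hand side with order `j` is `sliceSobolevEnergy (Kerr.exterior M a) ψ 0 j 0 univ`
(the weight `(1 + ‖y‖)^0 = 1` drops). [folklore] -/
theorem sliceSobolevEnergy_zero_univ_eq [Kerr.Facts] [Kerr.SliceFacts] (M a : ℝ) (j : ℕ)
    (ψ : Kerr.exterior M a → ℝ) :
    sliceSobolevEnergy (Kerr.exterior M a) ψ 0 j 0 univ =
      ∫⁻ y : E3, {y | E4.ofTimeSpace 0 y ∈ Kerr.exterior M a}.indicator (fun y ↦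
        ENNReal.ofReal (∑ m ∈ Finset.range (j + 1), ‖iteratedFDeriv ℝ m
          (Function.extend Subtype.val ψ (0 : E4 → ℝ)) (E4.ofTimeSpace 0 y)‖ ^ 2)) y := by
  simp only [sliceSobolevEnergy, Measure.restrict_univ, Real.rpow_zero, one_mul]

/-! ### The reduction -/

/-- **Near-extremal `κ`-explicit integrated decay: leaf form from graph form.**
HYPOTHESIS (written out; it is the `κ`-explicit near-extremal analogue of the vendored DRSR fact
`DafermosRodnianskiShlapentokhRothman2016_integratedDecay_uniform` with data of order `j`): for every
`M > 0` there are `a₁ < M`, `p`, `j`, `R₀ > 0` such that for every admissible height function `F` flat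
on `{‖y‖ ≤ ρ}`, `ρ ≥ R₀`, and every `R ≤ ρ` some `C < ∞` gives, for all `a₁ ≤ |a| < M` and all
admissible waves `ψ` (data compactly supported on the leaf `{t*_KS = 0}`, `IsAdmissibleKerrWave`)
which moreover have compactly supported data on the graph (`IsAdmissibleKerrWaveOn M a F`; both
hypotheses are offered, the second being what a DRSR-type proof uses),
`∫₀^∞ E_loc(τ, R) dτ ≤ C (1 − (a/M)²)^{-p} (E_j[ψ](Σ̃₀ ∩ {‖y‖ ≤ ρ}) + ∑_{i<j} E^far_F[T^iψ](0))`.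
CONCLUSION: the same estimate for admissible waves on the Kerr–Schild leaf `{t*_KS = 0}`
(`IsAdmissibleKerrWave`, written out) with the unweighted `j`-th order energy of the data on the whole
leaf on the right (same `a₁`, `p`, `j`; constant `(1 + 32 j) C(M, F_λ, λ, R)`) — clause (b) of the crux
`PhaseMixingCapture.KappaExplicitWaveDecay` on the near-extremal range. Proof: the `a`-uniform
Dafermos–Rodnianski reduction (arXiv:1010.5132, §4.6, Prop. 4.6.1) as in
`drsr_wave_integrated_decay_kerr_of_DRSR`: `a`-free scale `λ = max (4A, 4Ms, 293M + 2, R₀, R)` and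
height `heightFn M λ`; finite speed of propagation puts `T^iψ` (admissible,
`IsAdmissibleKerrWave.timeDeriv_iterate`) in the graph class with far graph energy
`≤ 8 sliceEnergy (T^iψ) 0 ≤ 32 E_j[ψ](0)` (`kerr_far_TEnergy_comparison_of_farRadius_le`,
`sliceEnergy_timeDeriv_iterate_le`), and `E_j(ball) ≤ E_j(univ)`.
[cite: DafermosRodnianski2010KerrSmallA, §4.6 Prop. 4.6.1] -/
theorem kerr_nearExtremal_integratedDecay_of_graphILED :
    (∀ [Kerr.Facts] [Kerr.SliceFacts], ∀ M : ℝ, 0 < M → ∃ (a₁ p : ℝ) (j : ℕ) (R₀ : ℝ), a₁ < M ∧ 0 < R₀ ∧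
      ∀ (F : E3 → ℝ) (ρ : ℝ), Kerr.IsAdmissibleHeight M F → R₀ ≤ ρ → (∀ y : E3, ‖y‖ ≤ ρ → F y = 0) →
        ∀ R : ℝ, R ≤ ρ → ∃ C : ℝ≥0∞, C < ⊤ ∧ ∀ a : ℝ, a₁ ≤ |a| → Kerr.IsSubextremal M a →
          ∀ ψ : Kerr.exterior M a → ℝ, IsAdmissibleKerrWave M a ψ → IsAdmissibleKerrWaveOn M a F ψ →
            ∫⁻ τ in Ioi (0 : ℝ), localSliceEnergy (Kerr.exterior M a) ψ τ R ≤
              C * ENNReal.ofReal ((1 - (a / M) ^ 2) ^ (-p)) *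
                (sliceSobolevEnergy (Kerr.exterior M a) ψ 0 j 0 (Metric.closedBall (0 : E3) ρ) +
                  ∑ i ∈ Finset.range j, graphSliceEnergyOn (Kerr.exterior M a) (timeDeriv^[i] ψ) F 0
                    {y | ρ < ‖y‖})) →
    (∀ [Kerr.Facts] [Kerr.SliceFacts], ∀ M : ℝ, 0 < M → ∃ (a₁ p : ℝ) (j : ℕ), a₁ < M ∧ ∀ R : ℝ, ∃ C : ENNReal, C < ⊤ ∧ ∀ a : ℝ, a₁ ≤ |a| → Kerr.IsSubextremal M a → ∀ ψ : Kerr.exterior M a → ℝ, (ContMDiff 𝓘(ℝ, E4) 𝓘(ℝ, ℝ) ((⊤ : ℕ∞) : WithTop ℕ∞) ψ ∧ (∀ x, (Kerr.smoothMetric M a (Kerr.rPlus M a)).toPseudoRiemannianMetric.dalembertian ψ x = 0) ∧ ∃ K : Set (Kerr.exterior M a), IsCompact K ∧ ∀ x : Kerr.exterior M a, (x : E4) 0 = 0 → x ∉ K → ψ x = 0 ∧ mfderiv 𝓘(ℝ, E4) 𝓘(ℝ, ℝ) ψ x = 0) → ∫⁻ τ in Ioi (0 : ℝ), localSliceEnergy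 (Kerr.exterior M a) ψ τ R ≤ C * ENNReal.ofReal ((1 - (a / M) ^ 2) ^ (-p)) * ∫⁻ y : E3, {y | E4.ofTimeSpace 0 y ∈ Kerr.exterior M a}.indicator (fun y ↦ ENNReal.ofReal (∑ m ∈ Finset.range (j + 1), ‖iteratedFDeriv ℝ m (Function.extend Subtype.val ψ (0 : E4 → ℝ)) (E4.ofTimeSpace 0 y)‖ ^ 2)) y) := by
  intro hG instF instS M hM
  obtain ⟨a₁, p, j, R₀, ha₁, hR₀, hG'⟩ := @hG instF instS M hM
  refine ⟨a₁, p, j, ha₁, fun R ↦ ?_⟩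
  obtain ⟨s, hs1, hCfar⟩ := kerr_far_finite_speed_of_propagation
  have hs0 : 0 ≤ s := zero_le_one.trans hs1
  -- ### the height function and its `a`-uniform scale
  obtain ⟨B, hB0, hBd⟩ := exists_bound_deriv_heightProfile
  set A : ℝ := 4 * M * B + 2 * M with hA_def
  have hA0 : 0 ≤ A := by positivity
  set l : ℝ := max (max (max (4 * A) (4 * M * s)) (293 * M + 2)) (max R₀ R) with hl_def
  have hl_A : 4 * A ≤ l := ((le_max_left _ _).trans (le_max_left _ _)).trans (le_max_left _ _)
  have hl_s : 4 * M * s ≤ l :=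
    ((le_max_right _ _).trans (le_max_left _ _)).trans (le_max_left _ _)
  have hl_unif : 293 * M + 2 ≤ l := (le_max_right _ _).trans (le_max_left _ _)
  have hl_R₀ : R₀ ≤ l := (le_max_left _ _).trans (le_max_right _ _)
  have hl_R : R ≤ l := (le_max_right _ _).trans (le_max_right _ _)
  have hl : 0 < l := (by positivity : (0 : ℝ) < 293 * M + 2).trans_le hl_unif
  set F : E3 → ℝ := heightFn M l with hF_def
  have hF_smooth : ContDiff ℝ ∞ F := contDiff_heightFn M l
  have hF_C1 : ContDiff ℝ 1 F := hF_smooth.of_le (ENat.natCast_le_of_coe_top_le_withTop le_rfl 1)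
  have hF_slope : ∀ y : E3, ‖fderiv ℝ F y‖ ≤ 1 / 4 := by
    intro y
    have h := norm_fderiv_heightFn_le_div hM.le hl hB0 hBd y
    have h2 : A / l ≤ 1 / 4 := by
      rw [div_le_iff₀ hl]; linarith
    rw [← hA_def] at h
    linarith
  have hF_zero : ∀ y : E3, ‖y‖ ≤ l → F y = 0 := fun y hy ↦ heightFn_of_norm_le hl hy
  have hF_nonneg : ∀ y : E3, 0 ≤ F y := heightFn_nonneg hM.le l
  have hF_sF : ∀ y : E3, s * F y ≤ ‖y‖ / 2 := by
    intro y
    have h := heightFn_le hM.le hl y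
    have h1 : s * F y ≤ s * (2 * M * ‖y‖ / l) := mul_le_mul_of_nonneg_left h hs0
    have h2 : s * (2 * M * ‖y‖ / l) ≤ ‖y‖ / 2 := by
      rw [← mul_div_assoc, div_le_div_iff₀ hl (by norm_num : (0:ℝ) < 2)]
      nlinarith [norm_nonneg y]
    exact h1.trans h2
  have hF_adm : Kerr.IsAdmissibleHeight M F :=
    ⟨hF_smooth, ⟨3 / 4, by norm_num, fun y ↦ by linarith [hF_slope y]⟩, _,
      tendsto_heightFn_sub_log hl⟩
  have hzero_C1 : ContDiff ℝ 1 (0 : E3 → ℝ) := contDiff_const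
  have hzero_slope : ∀ y : E3, ‖fderiv ℝ (0 : E3 → ℝ) y‖ ≤ 1 / 4 := by
    intro y; simp
  -- ### the graph statement for `F`, flat on `{‖y‖ ≤ λ}`: ONE constant for `a₁ ≤ |a| < M`
  obtain ⟨C, hC, hGψ⟩ := hG' F l hF_adm hl_R₀ hF_zero R hl_R
  have hjtop : ((1 : ℝ≥0∞) + 32 * j) < ⊤ :=
    ENNReal.add_lt_top.mpr ⟨ENNReal.one_lt_top, ENNReal.mul_lt_top (by simp) (by simp)⟩
  refine ⟨(1 + 32 * j) * C, ENNReal.mul_lt_top hjtop hC, fun a ha hMa ψ hψ ↦ ?_⟩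
  -- ### a spin in the range: far radius below the uniform scale
  have hl_far : Kerr.farRadius M a ≤ l := (Kerr.farRadius_le_of_isSubextremal hMa).trans hl_unif
  have hl_af : Kerr.afRadius a (Kerr.rPlus M a) < l :=
    (Kerr.afRadius_lt_farRadius M a).trans_le hl_far
  have hψ' : IsAdmissibleKerrWave M a ψ := hψ
  -- ### KEY: an admissible wave has compactly supported data on the graph of `F`, and its
  -- energy through the far part of the graph is at most `8 ×` its energy through `{t* = 0}`
  have key : ∀ φ : Kerr.exterior M a → ℝ, IsAdmissibleKerrWave M a φ →
      IsAdmissibleKerrWaveOn M a F φ ∧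
        graphSliceEnergyOn (Kerr.exterior M a) φ F 0 {y | l < ‖y‖} ≤
          8 * sliceEnergy (Kerr.exterior M a) φ 0 := by
    intro φ hφ
    obtain ⟨hsmooth, hsol, K, hK, hdata⟩ := hφ
    obtain ⟨ρ₀, -, hρ₀⟩ := exists_spatialNorm_le_of_isCompact hK
    set ρ : ℝ := max ρ₀ (Kerr.farRadius M a) with hρ_def
    have hρfar : Kerr.farRadius M a ≤ ρ := le_max_right _ _
    have hρ0 : 0 ≤ ρ := (Kerr.farRadius_pos M a).le.trans hρfar
    have hρ : ∀ x ∈ K, E4.spatialNorm (x : E4) ≤ ρ := fun x hx ↦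
      (hρ₀ x hx).trans (le_max_left _ _)
    -- finite speed of propagation (far region, speed `s`)
    have hvan : ∀ x : Kerr.exterior M a, 0 ≤ (x : E4) 0 →
        ρ + s * (x : E4) 0 < E4.spatialNorm (x : E4) →
        φ x = 0 ∧ mfderiv 𝓘(ℝ, E4) 𝓘(ℝ, ℝ) φ x = 0 := by
      refine hCfar M a hMa φ hsmooth hsol ρ hρfar fun x hx0 hxρ ↦ hdata x hx0 fun hxK ↦ ?_
      exact absurd (hρ x hxK) (not_le.mpr hxρ)
    -- `φ` has compactly supported data on the graph of `F`
    have hφF : IsAdmissibleKerrWaveOn M a F φ := by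
      refine ⟨hsmooth, hsol, ?_⟩
      set B₂ : Set E4 := (fun y : E3 ↦ E4.ofTimeSpace (F y) y) '' {y | l ≤ ‖y‖ ∧ ‖y‖ ≤ 2 * ρ}
        with hB₂_def
      have hB₂c : IsCompact B₂ := by
        refine IsCompact.image ?_ ?_
        · have : {y : E3 | l ≤ ‖y‖ ∧ ‖y‖ ≤ 2 * ρ} =
              {y | l ≤ ‖y‖} ∩ Metric.closedBall 0 (2 * ρ) := by
            ext y; simp [Metric.mem_closedBall, dist_zero_right]
          rw [this]
          exact (isCompact_closedBall _ _).inter_left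
            (isClosed_le continuous_const continuous_norm)
        · exact E4.continuous_ofTimeSpace' hF_smooth.continuous continuous_id
      have hB₂sub : B₂ ⊆ (Kerr.exterior M a : Set E4) := by
        rintro _ ⟨y, ⟨hy1, _⟩, rfl⟩
        exact Kerr.ofTimeSpace_mem_exterior_iff.mpr
          (Kerr.mem_slice_of_lt_norm (hl_af.trans_le hy1))
      set K' : Set (Kerr.exterior M a) := K ∪ Subtype.val ⁻¹' B₂ with hK'_def
      have hK'c : IsCompact K' := by
        refine hK.union ?_
        have hrange : B₂ ⊆ Set.range (Subtype.val : Kerr.exterior M a → E4) :=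
          fun x hx ↦ ⟨⟨x, hB₂sub hx⟩, rfl⟩
        rw [Topology.IsEmbedding.subtypeVal.isCompact_iff, Set.image_preimage_eq_of_subset hrange]
        exact hB₂c
      refine ⟨K', hK'c, fun x hx0 hxK' ↦ ?_⟩
      set y : E3 := E4.spatial (x : E4) with hy_def
      have hxy : (x : E4) = E4.ofTimeSpace (F y) y := by rw [← hx0]; exact eq_ofTimeSpace _
      have hsn : E4.spatialNorm (x : E4) = ‖y‖ := rfl
      by_cases hfar : 2 * ρ < ‖y‖
      · refine hvan x (hx0 ▸ hF_nonneg y) ?_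
        rw [hsn, hx0]
        have hh := hF_sF y
        nlinarith [hF_nonneg y]
      · push Not at hfar
        by_cases hnear : l ≤ ‖y‖
        · exact absurd (Or.inr ⟨y, ⟨hnear, hfar⟩, hxy.symm⟩ : x ∈ K') hxK'
        · push Not at hnear
          have h0 : (x : E4) 0 = 0 := by rw [hx0, hF_zero y hnear.le]
          exact hdata x h0 fun hxK ↦ hxK' (Or.inl hxK)
    refine ⟨hφF, ?_⟩
    -- the far `J^T` identity between the leaf `{t* = 0}` and the graph of `F` (a theorem)
    have hB := kerr_far_TEnergy_comparison_of_farRadius_le hMa hl_far (F₁ := 0) (F₂ := F)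
      hzero_C1 hF_C1 hzero_slope hF_slope (fun y hy ↦ by simp [hF_zero y hy])
      (fun y ↦ by simpa using hF_nonneg y) φ 0 hsmooth hsol
      ⟨2 * ρ + 1, fun x hx1 hx2 hx3 ↦ by
        simp only [Pi.zero_apply, add_zero] at hx1
        simp only [zero_add] at hx2
        refine hvan x hx1 ?_
        have hsn : E4.spatialNorm (x : E4) = ‖E4.spatial (x : E4)‖ := rfl
        have hh := hF_sF (E4.spatial (x : E4))
        have h2 := mul_le_mul_of_nonneg_left hx2 hs0
        rw [hsn] at hx3 ⊢
        nlinarith⟩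
    calc graphSliceEnergyOn (Kerr.exterior M a) φ F 0 {y | l < ‖y‖}
        ≤ 8 * graphSliceEnergyOn (Kerr.exterior M a) φ 0 0 {y | l < ‖y‖} := hB.1
      _ ≤ 8 * graphSliceEnergy (Kerr.exterior M a) φ 0 0 := by
          gcongr
          exact graphSliceEnergyOn_le _ _ _ _ _
      _ = 8 * sliceEnergy (Kerr.exterior M a) φ 0 := by rw [graphSliceEnergy_zero_height]
  -- ### the assembly for `ψ` and the `T^i ψ`, `i < j`
  obtain ⟨hψF, -⟩ := key ψ hψ'
  rw [← sliceSobolevEnergy_zero_univ_eq M a j ψ]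
  set Sj : ℝ≥0∞ := sliceSobolevEnergy (Kerr.exterior M a) ψ 0 j 0 univ with hSj_def
  have h1 : sliceSobolevEnergy (Kerr.exterior M a) ψ 0 j 0 (Metric.closedBall (0 : E3) l) ≤ Sj :=
    sliceSobolevEnergy_mono _ _ _ _ _ (subset_univ _)
  have h2 : ∀ i ∈ Finset.range j,
      graphSliceEnergyOn (Kerr.exterior M a) (timeDeriv^[i] ψ) F 0 {y | l < ‖y‖} ≤ 32 * Sj := by
    intro i hi
    have hij : i + 1 ≤ j := Finset.mem_range.mp hi
    obtain ⟨-, hfar⟩ := key (timeDeriv^[i] ψ) (hψ'.timeDeriv_iterate hM.le i)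
    calc graphSliceEnergyOn (Kerr.exterior M a) (timeDeriv^[i] ψ) F 0 {y | l < ‖y‖}
        ≤ 8 * sliceEnergy (Kerr.exterior M a) (timeDeriv^[i] ψ) 0 := hfar
      _ ≤ 8 * (4 * sliceSobolevEnergy (Kerr.exterior M a) ψ 0 (i + 1 + (j - (i + 1))) 0 univ) := by
          gcongr
          exact sliceEnergy_timeDeriv_iterate_le hψ'.contMDiff 0 i (j - (i + 1))
      _ = 32 * Sj := by
          rw [show i + 1 + (j - (i + 1)) = j by omega, ← mul_assoc, hSj_def]
          norm_num
  have h3 : ∑ i ∈ Finset.range j,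
      graphSliceEnergyOn (Kerr.exterior M a) (timeDeriv^[i] ψ) F 0 {y | l < ‖y‖} ≤
        ∑ _i ∈ Finset.range j, 32 * Sj := Finset.sum_le_sum h2
  rw [Finset.sum_const, Finset.card_range, nsmul_eq_mul] at h3
  calc ∫⁻ τ in Ioi (0 : ℝ), localSliceEnergy (Kerr.exterior M a) ψ τ R
      ≤ C * ENNReal.ofReal ((1 - (a / M) ^ 2) ^ (-p)) *
          (sliceSobolevEnergy (Kerr.exterior M a) ψ 0 j 0 (Metric.closedBall (0 : E3) l) +
            ∑ i ∈ Finset.range j, graphSliceEnergyOn (Kerr.exterior M a) (timeDeriv^[i] ψ) F 0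
              {y | l < ‖y‖}) := hGψ a ha hMa ψ hψ' hψF
    _ ≤ C * ENNReal.ofReal ((1 - (a / M) ^ 2) ^ (-p)) * (Sj + (j : ℝ≥0∞) * (32 * Sj)) := by
        gcongr
    _ = (1 + 32 * j) * C * ENNReal.ofReal ((1 - (a / M) ^ 2) ^ (-p)) * Sj := by ring

end Literature.Geometry.Lorentzian

end
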